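import Literature.MathematicalPhysics.QuantumFieldTheory.Balaban1983to89.B8SockH59NotAtCube
import Literature.MathematicalPhysics.QuantumFieldTheory.Balaban1983to89.B8LeafSocketsB9OfThm33

/-!
# `Balaban1983to89.B8JunctionH59Vacuity` — KERNEL CERTIFICATE (consequence of the located corner defect): the all-levels b9 socket
# `SockB9P3` of the N05 knit is UNSATISFIABLE at the concrete cube member `{□_j}` of (1.131), and therefore the hypotheses of the
# J-N06→N05 junction `B8LeafSocketsB9OfThm33.sB9all_of_thm33` (`B9.Thm33Printed` + the seven [4] Sect. A binders `DictGlob`, `Prop6Feed`,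
# `InvOnSupp`, `CurvSmall`, `LandauKills`, `AvgBound`, `HolderGlob`) are JOINTLY UNSATISFIABLE for `d ≥ 2`, `L ≥ 1` — as typed

statement-level skeleton of published theorems with citation tags; proofs where landed; nothing here is a claim about the
Yang–Mills mass gap

`[Balaban1985RegularSpaces]` ("B8", CMP **99** (1985) 75–102) (1.58)–(1.59) p. 86, Thm 4 p. 88, Prop. 6 p. 99, (1.131) p. 99, p. 77;
[4] = `[Balaban1985BackgroundPropagators]` Thm 3.3 p. 399, Sect. A (3.10)–(3.27) pp. 392–395.  PDF held: `paper:balaban1985-cmp99-regular-spaces-gauge-fixing`.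

CITATION HEADER (lean-in-tree rule).  Cell `pub-ymgap` (YM Track A, HUMAN RULING D-0062), DAG node N05 = [B8], seat `pub-ymgap-dag-n05-e` (g5;
director-ym R141 (C), FAN-OUT §N05 row s3b).  Fourth certificate of the located typing defect «(1.59) socket in the `SideTouches` currency at a
FINITE `Ω₀`» (`B8Ineq159FlatCornerDefect`, `B8SockH59CornerDefect`, `B8SockH59NotAtCube`).  BY NAME: `B8LeafSocketsB9.sockH59_of_allLevels`
(n05-a: the all-levels b9 socket implies Theorem 4's socket `SockH59` below `min cP (cP/K₀)`) + `B8SockH59NotAtCube.not_sockH59_cubeMember` ⇒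
★ `not_sockB9P3_allLevels_cubeMember`; and since `sB9all_of_thm33` delivers `SockB9P3` at EVERY member of `ZdIdx d L` — among them the cube
member (`B8CubeMemberZd.exists_member_cube`) — ★ `junction_hypotheses_unsatisfiable`: under the hypotheses of `sB9all_of_thm33` (verbatim
binder list), `False`.  WHAT THIS SAYS (count-neutral, for the N06 ∕ N05 owners): at least one of the junction's displayed hypotheses is
uninhabitable for every frame — the b9 socket family it derives is too strong at finite-`Ω₀` members (outer sides of corner plaquettes are
bounded on the left, unseen on the right); every N05 conclusion obtained THROUGH this junction is vacuous as typed.  Which binder to re-type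
(the socket's LHS over `BondTouches (Ω j)` plus a boundary term, or the member family restricted to `Ω 0 = ℤᵈ`, print's `(T, □₁, …, □_k)`) is
the owners' decision; nothing of theirs is restated here.

HONEST SCOPE.  By-name composition of landed theorems into a negative certificate; nothing of [4] ∕ [Balaban1985RegularSpaces] proved or
refuted (print is consistent: its (1.59) norms are suprema over bonds of `Ω_j` and its Prop.-6 family has `Ω₀ = T`); N05 ∕ N06 NOT
discharged; SECOND-GAP: none (typing); one finite `T⁴` programme at fixed `ε`, Bałaban as printed; nothing continuum ∕ ℝ⁴ ∕ OS ∕ mass-gap ∕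
Clay.  No `sorry`, no `def`, no `instance`, no `notation`.  Unit `pub-ymgap-dag-n05-e` (g5), 2026-08-27.
-/

noncomputable section

namespace Literature.MathematicalPhysics.QuantumFieldTheory.Balaban1983to89.B8JunctionH59Vacuity

open NormedSpace
open B7Prop1Explicit B7Prop2Explicit
open B8LeafModelZd (ZdIdx SockH59)
open B8LeafModelZd3 (SockB9P3)
open B8LeafSocketsB9 (sockH59_of_allLevels)
open B8LeafSocketsB9OfThm33 (sB9all_of_thm33)
open B9SupplySockB9P3ZdLetters (OpsZd DictGlob Prop6Feed InvOnSupp CurvSmall LandauKills AvgBound HolderGlob)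
open B8Eq131CubesAdmissible (cubeFam)
open B8CubeMemberZd (cubeLamS cubeLamB exists_member_cube)
open B8SockH59NotAtCube (not_sockH59_cubeMember)

export B7Prop1Explicit (Site)

variable {d : ℕ} {𝔸 : Type*} [CStarAlgebra 𝔸] [Nontrivial 𝔸]

/-- ★ **THE ALL-LEVELS b9 SOCKET IS UNSATISFIABLE AT THE CUBE MEMBER**: for `d ≥ 2`, `1 ≤ L ≤ ρ`, `η > 0`, `k ≥ 1`, `B₀ > 0`, `cP > 0`
(any `B₀β`, `β`, `len`), `¬ ∀ m ≤ k, SockB9P3 … m (cubeFam false …) (cubeLamS …) (cubeLamB …)` — by `sockH59_of_allLevels` (with `B₀′ = 0`)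
and `not_sockH59_cubeMember`. [cite: Balaban1985RegularSpaces, (1.58)–(1.59) p.86, Thm 4 p.88, (1.131) p.99; Balaban1985BackgroundPropagators, Thm 3.3 p.399] -/
theorem not_sockB9P3_allLevels_cubeMember (hd2 : 2 ≤ d) {L : ℕ} (hL : 1 ≤ L) {η : ℝ} (hη : 0 < η) (a : Site d) (M : ℕ) {ρ : ℕ}
    (hρ : L ≤ ρ) {k : ℕ} (hk : 1 ≤ k) {B₀ B₀β cP β : ℝ} {len : Site d → ℝ} (hB₀ : 0 < B₀) (hcP : 0 < cP) :
    ¬ (∀ m, m ≤ k → SockB9P3 (𝔸 := 𝔸) L B₀ B₀β cP β len η m (cubeFam false L a M ρ k) (cubeLamS L a M ρ k) (cubeLamB L a M ρ k)) := by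
  intro H
  have hd1 : 1 ≤ d := le_trans (by norm_num) hd2
  have hL0 : (0 : ℝ) < L := by exact_mod_cast hL
  have hd0 : (0 : ℝ) < d := by exact_mod_cast (lt_of_lt_of_le (by norm_num) hd2)
  have hK : 0 < min cP (cP / (2 * (L * (5 * (d : ℝ) * L * B₀)) + 8 * (8 * (0 : ℝ) * (5 * (d : ℝ) * L * B₀)))) := by
    refine lt_min hcP (div_pos hcP ?_)
    have h1 : 0 < 2 * (L * (5 * (d : ℝ) * L * B₀)) := by positivity
    simpa using h1
  exact not_sockH59_cubeMember hd2 hL hη a M hρ hk hB₀ le_rfl hK (sockH59_of_allLevels hd1 hL hB₀ le_rfl hcP H)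

section Junction

variable {I : Type} (geo : I → B9.Geometry) (bg : I → B9.Backgrounds) (GA : ∀ i, B9.KernelFamily (geo i) (bg i))
variable (L : ℕ) (mem : ℝ → ZdIdx d L → ℕ → I)
variable (ιCfg : ∀ (M : ℝ) (i : ZdIdx d L) (m : ℕ) (U₀ : Site d → Fin d → 𝔸ˣ),
  (∀ x κ, U₀ x κ ∈ unitaryUnits 𝔸) → (bg (mem M i m)).Cfg)
variable (ιLoc : ∀ (M : ℝ) (i : ZdIdx d L) (m : ℕ), (Site d → Fin d → 𝔸) → (geo (mem M i m)).Loc)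
variable (ops : ℝ → ZdIdx d L → ℕ → OpsZd d 𝔸)

/-- ★ **THE HYPOTHESES OF THE J-N06→N05 JUNCTION ARE JOINTLY UNSATISFIABLE (as typed, `d ≥ 2`, `L ≥ 1`)**: `B9.Thm33Printed c35 geo bg Gp GA`
together with the seven displayed [4] Sect. A binders of `B8LeafSocketsB9OfThm33.sB9all_of_thm33` (same binder list, verbatim) yields `False` —
because the junction delivers the all-levels b9 socket at EVERY member of `ZdIdx d L`, in particular at the cube member of (1.131)
(`exists_member_cube` with `a = 0`, `M = 0`, `ρ = L`, `k = 1`, `η = 1`), where it is refuted by `not_sockB9P3_allLevels_cubeMember`.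
[cite: Balaban1985RegularSpaces, (1.58)–(1.59) p.86, Thm 4 p.88, (1.131) p.99, p.77; Balaban1985BackgroundPropagators, Thm 3.3 p.399, (3.10)–(3.27) pp.392–395] -/
theorem junction_hypotheses_unsatisfiable (hd2 : 2 ≤ d) (hL : 1 ≤ L) {c35 c₆ K₆ M₃ a₃ c69 q CH β : ℝ} {len : Site d → ℝ}
    {Gp : ∀ i, B9.KernelFamily (geo i) (bg i)} (h33 : B9.Thm33Printed c35 geo bg Gp GA)
    (hdict : DictGlob geo bg GA L mem ιCfg ιLoc ops) (hP6 : Prop6Feed bg L mem ιCfg c35 M₃ c₆ K₆)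
    (hinv : InvOnSupp bg L mem ιCfg ops c35 M₃ a₃) (hcurv : CurvSmall bg L mem ιCfg ops c35 M₃ a₃ c69)
    (hlan : LandauKills bg L mem ιCfg ops c35 M₃ a₃) (havg : AvgBound L ops q)
    (hhol : HolderGlob geo bg GA L mem ιCfg ops β len CH)
    (hc₆ : 0 < c₆) (hK₆ : 0 < K₆) (ha₃ : 0 < a₃) (hc69 : 0 ≤ c69) (hq : 0 ≤ q) : False := by
  obtain ⟨B₀, B₀β, cP, hB₀, -, -, hcP, hall⟩ :=
    sB9all_of_thm33 geo bg GA L mem ιCfg ιLoc ops hd2 hL h33 hdict hP6 hinv hcurv hlan havg hhol hc₆ hK₆ ha₃ hc69 hq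
  obtain ⟨i, hk, hη, hΩ, hΛs, hΛb⟩ := exists_member_cube (d := d) hL (0 : Site d) 0 (le_refl L) (le_refl 1) one_pos
  have H : ∀ m, m ≤ 1 → SockB9P3 (𝔸 := 𝔸) L B₀ B₀β cP β len 1 m (cubeFam false L 0 0 L 1) (cubeLamS L 0 0 L 1) (cubeLamB L 0 0 L 1) := by
    intro m hm
    have h := hall i m (by rw [hk]; exact hm)
    rw [hη, hΩ, hΛs, hΛb] at h
    exact h
  exact not_sockB9P3_allLevels_cubeMember hd2 hL one_pos (0 : Site d) 0 (le_refl L) (le_refl 1) hB₀ hcP H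

#print axioms junction_hypotheses_unsatisfiable

end Junction

/-- ★ **THE FAMILY-WIDE b9 BINDER OF THE N05 KNIT OF RECORD IS UNSATISFIABLE**: the hypothesis `SB9all : ∀ i : ZdIdx d L, ∀ m ≤ i.k, SockB9P3 … i …`
of `B8LeafKnitZd3B9All.b8LeafRS_zd3_univ_b9all` (and the conclusion of `sB9all_of_thm33`) is FALSE for `d ≥ 2`, `L ≥ 1`, `B₀ > 0`, `cP > 0` (any `B₀β`,
`β`, `len`) — the family `ZdIdx d L` contains the cube member of (1.131) (`exists_member_cube`), where `not_sockB9P3_allLevels_cubeMember` applies.  (v1.1,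
appended.) [cite: Balaban1985RegularSpaces, (1.58)–(1.59) p.86, Thm 4 p.88, (1.131) p.99; Balaban1985BackgroundPropagators, Thm 3.3 p.399] -/
theorem not_sockB9P3_family (hd2 : 2 ≤ d) {L : ℕ} (hL : 1 ≤ L) {B₀ B₀β cP β : ℝ} {len : Site d → ℝ} (hB₀ : 0 < B₀) (hcP : 0 < cP) :
    ¬ (∀ (i : ZdIdx d L) (m : ℕ), m ≤ i.k → SockB9P3 (𝔸 := 𝔸) L B₀ B₀β cP β len i.η m i.Ω i.Λs i.Λb) := by
  intro hall
  obtain ⟨i, hk, hη, hΩ, hΛs, hΛb⟩ := exists_member_cube (d := d) hL (0 : Site d) 0 (le_refl L) (le_refl 1) one_pos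
  have H : ∀ m, m ≤ 1 → SockB9P3 (𝔸 := 𝔸) L B₀ B₀β cP β len 1 m (cubeFam false L 0 0 L 1) (cubeLamS L 0 0 L 1) (cubeLamB L 0 0 L 1) := by
    intro m hm
    have h := hall i m (by rw [hk]; exact hm)
    rw [hη, hΩ, hΛs, hΛb] at h
    exact h
  exact not_sockB9P3_allLevels_cubeMember hd2 hL one_pos (0 : Site d) 0 (le_refl L) (le_refl 1) hB₀ hcP H

#print axioms not_sockB9P3_family

end Literature.MathematicalPhysics.QuantumFieldTheory.Balaban1983to89.B8JunctionH59Vacuity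

end
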